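import Summits.HodgeConjecture.CorCM.GaloisOddMetacyclicCertificates
import HarnessLib

/-!
# `Gal(K/ℚ) ≅ C₇ ⋊ C₈` is BAD: a simple DEGENERATE CM abelian `28`-fold (kernel certificate)

COR-CM (cell `pub-hodgecm2`), binder seat b04 (gen 26), count-neutral claim CYCLIC-SEMIDIRECT-RESIDUE, part VII♯a — the first
group on the BAD side of the boundary of `CorCM/GaloisCyclicSemidirectTwoPowerResidue` beyond order `24`: `C₇ ⋊ C₈` (order
`56`, `a = 1`, `p = 7 ≡ 7 (mod 8)`: `2^{a+1} = 4 ∣ p + 1`, so a primitive fourth root of unity IS a norm from `ℚ(ζ₂₈)` to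
`ℚ(i, ζ₇ + ζ₇⁻¹)` and the GOOD mechanism fails).  The seat census (two-sheet, exhaustive over the `4⁷ × 4⁷` interval types;
gen 25 §C and compute job j199053) finds `90 960` degenerate sheet pairs, almost all primitive; ONE of them with a balanced
set of size `8` (found by SAT, python-sat `g3`) is recorded here and checked by `decide` through the certificate format
`GaloisOddMetacyclic.exists_simple_degenerate_of_inversion_balanced` (part VI♯), under the SAME hypothesis
`e : Gal(K/ℚ) ≃* Multiplicative (ZMod 7) ⋊[φ] Multiplicative (ZMod 8)` (`φ(1)` = inversion) as the GOOD theorems.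
KERNEL ONLY: theorems; no definition, no named fact, no `sorry`.  `HC_CM` is neither used nor claimed.

THE CERTIFICATE (coordinates `(v, s) ↔ u^v y^s ∈ ℤ/7 × ℤ/8`, law `(v₁,s₁)(v₂,s₂) = (v₁ + 6^{s₁}v₂, s₁+s₂)`, `c₀ = (0,4)`):
the CM set `T₀` is the two-sheet type with interval fibres `t = (0,1,1,2,0,0,1)`, `t' = (3,2,3,2,2,1,3)` (B-rank `29 − 12`);
`D = {(1,3), (2,7), (3,7), (4,2), (4,4), (5,3), (6,0), (6,6)}` meets every right translate `T₀ g⁻¹` in exactly `4` points.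

* **`exists_simple_degenerate_cyclic7_semidirect_8`**: a simple degenerate abelian variety of dimension `28` with CM by `K`
  and a rational `(q,q)` class outside the divisor ring on some power — `C₇ ⋊ C₈` is BAD (whereas `C₅ ⋊ C₈`, `C₁₃ ⋊ C₈`
  are GOOD, `CorCM/GaloisCyclicSemidirectEightFiveModEight`, and `C₇ ⋊ C₃₂` is GOOD, part IV♯).

## References

* [Shimura1998] G. Shimura, *Abelian Varieties with Complex Multiplication and Modular Functions*, §6.2 Thm. 3, §8.2 Prop. 26.
* [Gordon1999HodgeAVSurvey] B. B. Gordon, *A survey of the Hodge conjecture for abelian varieties*, Thm. 6.4, §9.3.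
-/

noncomputable section

open CategoryTheory CategoryTheory.Limits NumberField
open scoped BigOperators

namespace Summit.HodgeConjecture.CorCM.GaloisOddMetacyclic

open Literature.NumberTheory.ComplexMultiplication
open Literature.AlgebraicGeometry.Motives (AbelianVariety CMType)
open Literature.AlgebraicGeometry.HodgeTheory
open Literature.AlgebraicGeometry.ComplexMultiplication (IsCMTypeRealisation)
open Literature.AlgebraicGeometry.Pohlmann1968
open Literature.Barriers.HodgeConjecture (divisorClassesSpan)

variable {K : Type} [Field K] [NumberField K] [IsCMField K] [IsGalois ℚ K]

set_option maxRecDepth 8000 in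
/-- **`Gal(K/ℚ) ≅ C₇ ⋊ C₈` (`φ(1)` = inversion): a simple DEGENERATE abelian `28`-fold with CM by `K`**, with a rational
`(q,q)` class outside the divisor ring on some power — by the balanced-set certificate `(T₀, D)` above, checked by `decide`.
[cite: Shimura1998, §6.2 Thm. 3 and §8.2 Prop. 26] [cite: Gordon1999HodgeAVSurvey, Thm. 6.4 and §9.3] -/
theorem exists_simple_degenerate_cyclic7_semidirect_8
    (φ : Multiplicative (ZMod (2 ^ (1 + 2))) →* MulAut (Multiplicative (ZMod 7)))
    (hφ : ∀ v : Multiplicative (ZMod 7), φ (Multiplicative.ofAdd 1) v = v⁻¹)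
    (e : (K ≃ₐ[ℚ] K) ≃* Multiplicative (ZMod 7) ⋊[φ] Multiplicative (ZMod (2 ^ (1 + 2)))) :
    ∃ (Φ : CMType K) (φ₀ : K →+* ℂ) (A : AbelianVariety ℂ) (ι : 𝓞 K →+* End A)
      (θ : K →+* Module.End ℂ (complexBetti A.X 1)),
      IsPrimitive (ℂ ≃+* ℂ) Φ.1 φ₀ ∧ ¬ IsNondegenerate Φ ∧ IsCMTypeRealisation Φ A ι θ ∧ A.IsSimple ∧ A.dim = 28 ∧
      ∃ n q : ℕ, ∃ x : complexBetti (⨁ fun _ : Fin n => A).X (2 * q), IsRationalClass x ∧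
        IsOfHodgeType (⨁ fun _ : Fin n => A).dim (⨁ fun _ : Fin n => A).X (2 * q) q q x ∧
        x ∉ divisorClassesSpan (⨁ fun _ : Fin n => A).X (⨁ fun _ : Fin n => A).dim q := by
  obtain ⟨Φ, φ₀, A, ι, θ, h1, h2, h3, h4, h5, h6⟩ :=
    exists_simple_degenerate_of_inversion_balanced (a := 1) (K := K) (by norm_num) (by norm_num) φ hφ e
      {(0, 0), (0, 1), (0, 2), (0, 7), (1, 2), (1, 4), (1, 5), (1, 7), (2, 1), (2, 2), (2, 4), (2, 7), (3, 4), (3, 5), (3, 6),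
        (3, 7), (4, 0), (4, 2), (4, 5), (4, 7), (5, 0), (5, 2), (5, 3), (5, 5), (6, 1), (6, 2), (6, 4), (6, 7)}
      (by decide) (by decide) {(1, 3), (2, 7), (3, 7), (4, 2), (4, 4), (5, 3), (6, 0), (6, 6)} (by decide) (by decide)
  exact ⟨Φ, φ₀, A, ι, θ, h1, h2, h3, h4, by norm_num at h5; exact h5, h6⟩

end Summit.HodgeConjecture.CorCM.GaloisOddMetacyclic

end
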